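import Summits.Ventures.CertifiedManyBodySolver.Downfold.TperpSeamTwoDimerDiagU
import Summits.Ventures.CertifiedManyBodySolver.Downfold.BoxesYBCO6
import Literature.MathematicalPhysics.QuantumLattice.HubbardTTPrimeAffineBoxWords
import Literature.MathematicalPhysics.QuantumLattice.HubbardFermiSeaTangentRows
import Literature.MathematicalPhysics.QuantumLattice.HubbardFermiSeaTangentRowsBoxEnds
import HarnessLib

/-!
# FIRST CLOSED BILAYER-CRYSTAL FLOOR WORDS on `boxYBCO7M_M130` (YBa₂Cu₃O₇.₀₀) and `boxYBCO6M_M64` (YBa₂Cu₃O₆ parent),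
# `U`-DRESSED on both vertical bond classes (hubbard-box-p3, 2026-08-28)

Venture CertifiedManyBodySolver, cell `pub/hubbard-downfold` box schema; S2 seat `hubbard-box-p3` (cell `pub/hubbard-fast`). The two-dimer seam
`TperpSeamTwoDimerDiagU.holdsOn_bilayerHubbardTTPrime_floor_of_anchorCell_twoDimer` wants an S2 floor on a source cell reaching `U = U_a` with
`U_a + (V₁+V₂)·tperp_hi ≤ U_lo`; the landed `aw_…proj…_word`s of these two boxes live on the boxes' own `U`-ranges, so here the source floors are
`U`-UNIFORM FREE-FERMI-SEA floors (`U_a = 0`): two certified free tangent rows per box at the `t'`-columns enclosing the box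
(`HubbardFermiSeaTangentRows{,BoxEnds}`), joined by joint `(t', U)`-concavity (`energyDensityTT'_affineFloor_Icc₃_of_cornerRows`, constant form).

* `ybco7M_M130_freeFloor` — `−1.5426584 ≤ e₀(1, θ 1, θ 0, θ 2)` on `[0, 20] × [−3/10, −17/100] × [39/50, 83/100]` (rows `−3/10 @ 21/25`, `−17/100 @ 9/10`).
* `ybco6M_M64_freeFloor` — `−1.7163628 ≤ e₀` on `[0, 20] × [−3/10, −13/100] × [99/100, 101/100]` (rows `−3/10 @ 1`, `−13/100 @ 18/25`).
* **`boxYBCO7M_M130_bilayer_floor_twoDimerV6{,_decimal}`** (`tperp/t ∈ [0.3, 0.45]`, `n ∈ [0.78, 0.83]`; `V₁ = V₂ = 6`, `5.4 ≤ 5.8`):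
  **`−1.893303 ≤ inf_{period-2 periodic, filling p n} e(bilayer t–t' crystal)`** for every `|t⊥'| ≤ |p tperp/t|` — the box carried entry points only
  (`BoxesYBCO7Words`); the kinematic seam on the proj floor `−1.5407746` would give `−2.4407746`.
* **`boxYBCO6M_M64_bilayer_floor_twoDimer{,_decimal}`** (`tperp/t ∈ [0.22, 0.29]`, `n ∈ [0.99, 1.01]`; `V₁ = 12` intra, `V₂ = 6` inter, `18·0.29 = 5.22 ≤ 5.4`):
  **`−1.854361 ≤ inf …`** — kinematic seam on the proj floor `−1.6705800`: `−2.2505800`.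

Everything is PROVED; no definition, no number of record. HONEST FRAMING: hypothesis-free energy FLOORS for the period-2 stacked one-band (object-M
`t–t'` projection) crystal over its period-2 periodic states at the box's plane filling; the in-plane ingredient is the FREE Fermi sea (valid at every
`U ≥ 0`, hence loose at the boxes' `U/t ≥ 5.4`); no cap, no order / pairing / `T_c` content, no material measurement.
-/

noncomputable section

namespace Summit.Ventures.CertifiedManyBodySolver.Downfold

open NonemptyInterval Literature.MathematicalPhysics.QuantumLattice
  Literature.MathematicalPhysics.QuantumLattice.ThermodynamicLimit Literature.Probability.LatticeModels
open Literature.MathematicalPhysics.QuantumLattice.TTPrimeFree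
open Summit.Ventures.CertifiedManyBodySolver.Certificates

/-! ### `U`-uniform free-Fermi-sea source floors -/

/-- **Free-sea floor for the `M130` cell**: `−1.5426584 ≤ e₀(1, t', U, n)` on `U ∈ [0, 20]`, `t' ∈ [−3/10, −17/100]`, `n ∈ [39/50, 83/100]`
(tangent rows at the two columns, constant below the four corner values, joint concavity in between). [cite: Israel1979, Thm. I.3.4] -/
theorem ybco7M_M130_freeFloor :
    ∀ θ ∈ Set.Icc (![0, -3/10, 39/50] : Fin 3 → ℝ) ![20, -17/100, 83/100],
      (-1.5426584 : ℝ) ≤ energyDensityTT' 1 (θ 1) (θ 0) (θ 2) := by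
  have r11 : ∀ m ∈ Set.Icc (39/50 : ℝ) (83/100 : ℝ), (-0.6432533146 : ℝ) + (-539 / 512 : ℝ) * m ≤ energyDensityTT' 1 (-3/10) 0 m :=
    fun m hm => fermiSeaTangentRow_tPrime_neg_three_div_ten_at_twentyone_div_twentyfive (U := (0 : ℝ)) le_rfl
      (le_trans (by norm_num) hm.1) (lt_of_le_of_lt hm.2 (by norm_num))
  have r12 : ∀ m ∈ Set.Icc (39/50 : ℝ) (83/100 : ℝ), (-1.0226925649 : ℝ) + (-1283 / 2048 : ℝ) * m ≤ energyDensityTT' 1 (-17/100) 0 m :=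
    fun m hm => fermiSeaTangentRow_tPrime_neg_seventeen_div_hundred_at_nine_div_ten (U := (0 : ℝ)) le_rfl
      (le_trans (by norm_num) hm.1) (lt_of_le_of_lt hm.2 (by norm_num))
  have r21 : ∀ m ∈ Set.Icc (39/50 : ℝ) (83/100 : ℝ), (-0.6432533146 : ℝ) + (-539 / 512 : ℝ) * m ≤ energyDensityTT' 1 (-3/10) 20 m :=
    fun m hm => fermiSeaTangentRow_tPrime_neg_three_div_ten_at_twentyone_div_twentyfive (U := (20 : ℝ)) (by norm_num)
      (le_trans (by norm_num) hm.1) (lt_of_le_of_lt hm.2 (by norm_num))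
  have r22 : ∀ m ∈ Set.Icc (39/50 : ℝ) (83/100 : ℝ), (-1.0226925649 : ℝ) + (-1283 / 2048 : ℝ) * m ≤ energyDensityTT' 1 (-17/100) 20 m :=
    fun m hm => fermiSeaTangentRow_tPrime_neg_seventeen_div_hundred_at_nine_div_ten (U := (20 : ℝ)) (by norm_num)
      (le_trans (by norm_num) hm.1) (lt_of_le_of_lt hm.2 (by norm_num))
  intro θ hθ
  have h := energyDensityTT'_affineFloor_Icc₃_of_cornerRows 1 (le_refl (0 : ℝ)) (by norm_num) (by norm_num) r11 r12 r21 r22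
    (L₀ := (-1.5426584 : ℝ)) (L₁ := 0) (L₂ := 0) (L₃ := 0)
    (by norm_num) (by norm_num) (by norm_num) (by norm_num) (by norm_num) (by norm_num) (by norm_num) (by norm_num) θ hθ
  simpa using h

/-- **Free-sea floor for the `M64` cell**: `−1.7163628 ≤ e₀(1, t', U, n)` on `U ∈ [0, 20]`, `t' ∈ [−3/10, −13/100]`, `n ∈ [99/100, 101/100]`
(tangent rows `−3/10 @ 1` and `−13/100 @ 18/25`). [cite: Israel1979, Thm. I.3.4] -/
theorem ybco6M_M64_freeFloor :
    ∀ θ ∈ Set.Icc (![0, -3/10, 99/100] : Fin 3 → ℝ) ![20, -13/100, 101/100],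
      (-1.7163628 : ℝ) ≤ energyDensityTT' 1 (θ 1) (θ 0) (θ 2) := by
  have r11 : ∀ m ∈ Set.Icc (99/100 : ℝ) (101/100 : ℝ), (-1.0059737133 : ℝ) + (-1349 / 2048 : ℝ) * m ≤ energyDensityTT' 1 (-3/10) 0 m :=
    fun m hm => fermiSeaTangentRow_tPrime_neg_three_div_ten_at_one (U := (0 : ℝ)) le_rfl
      (le_trans (by norm_num) hm.1) (lt_of_le_of_lt hm.2 (by norm_num))
  have r12 : ∀ m ∈ Set.Icc (99/100 : ℝ) (101/100 : ℝ), (-0.8567777866 : ℝ) + (-1743 / 2048 : ℝ) * m ≤ energyDensityTT' 1 (-13/100) 0 m :=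
    fun m hm => fermiSeaTangentRow_tPrime_neg_thirteen_div_hundred_at_eighteen_div_twentyfive (U := (0 : ℝ)) le_rfl
      (le_trans (by norm_num) hm.1) (lt_of_le_of_lt hm.2 (by norm_num))
  have r21 : ∀ m ∈ Set.Icc (99/100 : ℝ) (101/100 : ℝ), (-1.0059737133 : ℝ) + (-1349 / 2048 : ℝ) * m ≤ energyDensityTT' 1 (-3/10) 20 m :=
    fun m hm => fermiSeaTangentRow_tPrime_neg_three_div_ten_at_one (U := (20 : ℝ)) (by norm_num)
      (le_trans (by norm_num) hm.1) (lt_of_le_of_lt hm.2 (by norm_num))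
  have r22 : ∀ m ∈ Set.Icc (99/100 : ℝ) (101/100 : ℝ), (-0.8567777866 : ℝ) + (-1743 / 2048 : ℝ) * m ≤ energyDensityTT' 1 (-13/100) 20 m :=
    fun m hm => fermiSeaTangentRow_tPrime_neg_thirteen_div_hundred_at_eighteen_div_twentyfive (U := (20 : ℝ)) (by norm_num)
      (le_trans (by norm_num) hm.1) (lt_of_le_of_lt hm.2 (by norm_num))
  intro θ hθ
  have h := energyDensityTT'_affineFloor_Icc₃_of_cornerRows 1 (le_refl (0 : ℝ)) (by norm_num) (by norm_num) r11 r12 r21 r22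
    (L₀ := (-1.7163628 : ℝ)) (L₁ := 0) (L₂ := 0) (L₃ := 0)
    (by norm_num) (by norm_num) (by norm_num) (by norm_num) (by norm_num) (by norm_num) (by norm_num) (by norm_num) θ hθ
  simpa using h

/-! ### The dimer rows used -/

/-- **The `V = 12` dimer chord through `k = 1, 2` as unit rows on the open `2 × 1` cluster**:
`−1.6755447 + 0.6754445·k ≤ E₀(h_{2×1}(1, 0, 12), k)`, `k ≤ 4`. [cite: KullEtAl2024, §5.3] -/
theorem dimer_V12_rows_k12 : ∀ k : ℕ, k ≤ 4 →
    (((-16755447 : ℚ) / 10000000 : ℚ) : ℝ) + (((1350889 : ℚ) / 2000000 : ℚ) : ℝ) * k ≤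
      groundEnergy (hubbardOpenBoxTT' 2 1 1 0 (12 : ℝ)) k := by
  intro k hk
  have h1 := dimer_V12_line_k12 k hk
  have h2 := dimer_V12_table k hk
  have h1' : (((-16755447 : ℚ) / 10000000 : ℚ) : ℝ) + (((1350889 : ℚ) / 2000000 : ℚ) : ℝ) * k ≤ ((dimer_V12_sigma k : ℚ) : ℝ) := by
    exact_mod_cast h1
  exact h1'.trans h2

/-! ### YBa₂Cu₃O₇.₀₀ (`boxYBCO7M_M130`, VSET-v4 M130): `U/t ∈ [5.8, 14.8]`, `tp/t ∈ [−0.3, −0.19]`, `n ∈ [0.78, 0.83]`, `tperp/t ∈ [0.3, 0.45]` -/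

/-- **YBa₂Cu₃O₇.₀₀ bilayer floor, both vertical classes `U`-dressed (`V₁ = V₂ = 6`), HYPOTHESIS-FREE**: for every member and every
`|t⊥'| ≤ |p tperp/t|`, `−1.5426584 − 0.1753221 − 0.1753221 ≤ inf_{period-2 periodic, filling p n} e(bilayer t–t' crystal)` (`= −1.8933026`).
[cite: Anderson1951, eq. (2)] -/
theorem boxYBCO7M_M130_bilayer_floor_twoDimerV6 :
    HoldsOn (fun p : OneBandCoord → ℝ => ∀ tperp' : ℝ, |tperp'| ≤ |p .tperpOverT| →
      (-1.5426584 : ℝ) + (-0.1753221 : ℝ) + (-0.1753221 : ℝ) ≤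
        infCellEnergyOn (periodicStatesAt (stackPeriods 2 1) (p .filling))
          (periodicLayeredHubbardTTPrimeViews 1 1 (p .tpOverT) (p .UOverT)
            (fun _ : Fin 1 => (unitVec (0 : Fin 3) : Site 3)) fun j _ => ![p .tperpOverT, tperp'] j) 1) boxYBCO7M_M130 :=
  holdsOn_bilayerHubbardTTPrime_floor_of_anchorCell_twoDimer (B := boxYBCO7M_M130) (eU := yBCO7M_M130_U)
    (eS := yBCO7M_M130_tp) (eN := yBCO7M_M130_n) (eZ := yBCO7M_M130_tperp) rfl rfl rfl rfl
    (by rw [yBCO7M_M130_n, Entry.encl_ofEnds_fst]; norm_num)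
    (by rw [yBCO7M_M130_n, Entry.encl_ofEnds_snd]; norm_num)
    (by rw [yBCO7M_M130_tperp, Entry.encl_ofEnds_fst]; norm_num)
    ybco7M_M130_freeFloor (Ua := 0) (V₁ := 6) (V₂ := 6) le_rfl ⟨le_rfl, by norm_num⟩
    (by rw [yBCO7M_M130_tp, Entry.encl_ofEnds_fst, Entry.encl_ofEnds_snd]; constructor <;> norm_num)
    (by rw [yBCO7M_M130_n, Entry.encl_ofEnds_fst, Entry.encl_ofEnds_snd]; constructor <;> norm_num)
    (by norm_num) (by norm_num)
    (by rw [yBCO7M_M130_tperp, Entry.encl_ofEnds_snd, yBCO7M_M130_U, Entry.encl_ofEnds_fst]; norm_num)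
    dimer_V6_rows_k12 dimer_V6_rows_k12 (c₁ := (-0.1753221 : ℝ)) (c₂ := (-0.1753221 : ℝ))
    (by
      rw [yBCO7M_M130_tperp, Entry.encl_ofEnds_fst, Entry.encl_ofEnds_snd, yBCO7M_M130_n, Entry.encl_ofEnds_fst,
        Entry.encl_ofEnds_snd]
      intro z n hz hn
      push_cast at hz hn ⊢
      exact mul_half_affine_ge_of_corners (by norm_num) (by norm_num) (by norm_num) (by norm_num) (by norm_num) hz hn)
    (by
      rw [yBCO7M_M130_tperp, Entry.encl_ofEnds_snd, yBCO7M_M130_n, Entry.encl_ofEnds_fst, Entry.encl_ofEnds_snd]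
      intro w n hw hn
      push_cast at hw hn ⊢
      exact mul_half_affine_ge_of_corners le_rfl (by norm_num) (by norm_num) (by norm_num) (by norm_num) hw hn)

/-- **Decimal form on `boxYBCO7M_M130`**: `−1.893303 ≤ inf …` for every `|t⊥'| ≤ |p tperp/t|` (kinematic seam on the proj floor: `−2.4407746`).
[cite: Anderson1951, eq. (2)] -/
theorem boxYBCO7M_M130_bilayer_floor_twoDimerV6_decimal :
    HoldsOn (fun p : OneBandCoord → ℝ => ∀ tperp' : ℝ, |tperp'| ≤ |p .tperpOverT| →
      (-1.893303 : ℝ) ≤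
        infCellEnergyOn (periodicStatesAt (stackPeriods 2 1) (p .filling))
          (periodicLayeredHubbardTTPrimeViews 1 1 (p .tpOverT) (p .UOverT)
            (fun _ : Fin 1 => (unitVec (0 : Fin 3) : Site 3)) fun j _ => ![p .tperpOverT, tperp'] j) 1) boxYBCO7M_M130 := by
  intro p hp tperp' htp
  have h := boxYBCO7M_M130_bilayer_floor_twoDimerV6 p hp tperp' htp
  norm_num at h ⊢
  linarith

/-! ### YBa₂Cu₃O₆.₀₀ (`boxYBCO6M_M64`, VSET-v2 #64): `U/t ∈ [5.4, 13.6]`, `tp/t ∈ [−0.28, −0.15]`, `n ∈ [0.99, 1.01]`, `tperp/t ∈ [0.22, 0.29]` -/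

/-- **YBa₂Cu₃O₆ bilayer parent floor, both vertical classes `U`-dressed (`V₁ = 12` intra, `V₂ = 6` inter), HYPOTHESIS-FREE**: for every member and
every `|t⊥'| ≤ |p tperp/t|`, `−1.7163628 − 0.0490339 − 0.0889635 ≤ inf_{period-2 periodic, filling p n} e(bilayer t–t' crystal)` (`= −1.8543602`).
[cite: Anderson1951, eq. (2)] -/
theorem boxYBCO6M_M64_bilayer_floor_twoDimer :
    HoldsOn (fun p : OneBandCoord → ℝ => ∀ tperp' : ℝ, |tperp'| ≤ |p .tperpOverT| →
      (-1.7163628 : ℝ) + (-0.0490339 : ℝ) + (-0.0889635 : ℝ) ≤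
        infCellEnergyOn (periodicStatesAt (stackPeriods 2 1) (p .filling))
          (periodicLayeredHubbardTTPrimeViews 1 1 (p .tpOverT) (p .UOverT)
            (fun _ : Fin 1 => (unitVec (0 : Fin 3) : Site 3)) fun j _ => ![p .tperpOverT, tperp'] j) 1) boxYBCO6M_M64 :=
  holdsOn_bilayerHubbardTTPrime_floor_of_anchorCell_twoDimer (B := boxYBCO6M_M64) (eU := yBCO6M_M64_U)
    (eS := yBCO6M_M64_tp) (eN := yBCO6M_M64_n) (eZ := yBCO6M_M64_tperp) rfl rfl rfl rfl
    (by rw [yBCO6M_M64_n, Entry.encl_ofEnds_fst]; norm_num)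
    (by rw [yBCO6M_M64_n, Entry.encl_ofEnds_snd]; norm_num)
    (by rw [yBCO6M_M64_tperp, Entry.encl_ofEnds_fst]; norm_num)
    ybco6M_M64_freeFloor (Ua := 0) (V₁ := 12) (V₂ := 6) le_rfl ⟨le_rfl, by norm_num⟩
    (by rw [yBCO6M_M64_tp, Entry.encl_ofEnds_fst, Entry.encl_ofEnds_snd]; constructor <;> norm_num)
    (by rw [yBCO6M_M64_n, Entry.encl_ofEnds_fst, Entry.encl_ofEnds_snd]; constructor <;> norm_num)
    (by norm_num) (by norm_num)
    (by rw [yBCO6M_M64_tperp, Entry.encl_ofEnds_snd, yBCO6M_M64_U, Entry.encl_ofEnds_fst]; norm_num)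
    dimer_V12_rows_k12 dimer_V6_rows_k12 (c₁ := (-0.0490339 : ℝ)) (c₂ := (-0.0889635 : ℝ))
    (by
      rw [yBCO6M_M64_tperp, Entry.encl_ofEnds_fst, Entry.encl_ofEnds_snd, yBCO6M_M64_n, Entry.encl_ofEnds_fst,
        Entry.encl_ofEnds_snd]
      intro z n hz hn
      push_cast at hz hn ⊢
      exact mul_half_affine_ge_of_corners (by norm_num) (by norm_num) (by norm_num) (by norm_num) (by norm_num) hz hn)
    (by
      rw [yBCO6M_M64_tperp, Entry.encl_ofEnds_snd, yBCO6M_M64_n, Entry.encl_ofEnds_fst, Entry.encl_ofEnds_snd]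
      intro w n hw hn
      push_cast at hw hn ⊢
      exact mul_half_affine_ge_of_corners le_rfl (by norm_num) (by norm_num) (by norm_num) (by norm_num) hw hn)

/-- **Decimal form on `boxYBCO6M_M64`**: `−1.854361 ≤ inf …` for every `|t⊥'| ≤ |p tperp/t|` (kinematic seam on the proj floor: `−2.2505800`).
[cite: Anderson1951, eq. (2)] -/
theorem boxYBCO6M_M64_bilayer_floor_twoDimer_decimal :
    HoldsOn (fun p : OneBandCoord → ℝ => ∀ tperp' : ℝ, |tperp'| ≤ |p .tperpOverT| →
      (-1.854361 : ℝ) ≤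
        infCellEnergyOn (periodicStatesAt (stackPeriods 2 1) (p .filling))
          (periodicLayeredHubbardTTPrimeViews 1 1 (p .tpOverT) (p .UOverT)
            (fun _ : Fin 1 => (unitVec (0 : Fin 3) : Site 3)) fun j _ => ![p .tperpOverT, tperp'] j) 1) boxYBCO6M_M64 := by
  intro p hp tperp' htp
  have h := boxYBCO6M_M64_bilayer_floor_twoDimer p hp tperp' htp
  norm_num at h ⊢
  linarith

end Summit.Ventures.CertifiedManyBodySolver.Downfold

end
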